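import Summits.BirchSwinnertonDyer.BirchSwinnertonDyer.Theorems.ByReductionTypeAtTwoTorsionEulerCharIneq
import Summits.BirchSwinnertonDyer.BirchSwinnertonDyer.Theorems.ByReductionTypeAtTwoSupersingularFlatLiftAssemblyTop
import HarnessLib

set_option linter.dupNamespace false -- `…BirchSwinnertonDyer.BirchSwinnertonDyer…` is the cell's nested layout (D-0017)
set_option autoImplicit false

/-!
# Greenberg LNM 1716 Lemma 4.7 WITH RATIONAL `p`-TORSION, part 7: Greenberg's map
# `t : 𝒫^Σ(F)/𝒢^Σ(F) → (Sel_E(F_∞)_p)_Γ` at ONE auxiliary place `v₀`, MODULO LEMMA 4.6 ON `Γ`-INVARIANTS — the three lemmas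
# behind the REVERSE inequality `#ker g₀ · #C_{v₀} ≤ ∏_{v∈S} #𝒦_{v,0}[p^∞] · #(Sel_∞)_γ`

Cell `bsd-2adic` (run/shared/lean/pub/bsd-2adic/), seat `bsd-2adic-tower-1` GEN 32; `--supports stmt-BirchSwinnertonDyer-19271`
(helper). THEOREMS ONLY (no definition, no named fact, no `sorry`); closes no item; nothing booked; BSD is not proved by any of this.

R. Greenberg, *Iwasawa theory for elliptic curves*, LNM 1716 (1999), §4 Lemma 4.7 (pp. 107–108): `|ker g|·|E(F)_p| =
|ker r|·|(Sel_E(F_∞)_p)_Γ|`, through the diagram whose second row `Im(b) → 𝒫_E^Σ(F_∞)^Γ → (Sel_E(F_∞)_p)_Γ → 0` needs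
LEMMA 4.6 («the map `H¹(F_Σ/F_∞, E[p^∞]) → 𝒫_E^Σ(F_∞)` is surjective», twists `A_s` + Prop. 4.13). Parts 1–5 of this series
(GEN 31) proved the «`≥`» half of Lemma 4.7 for every number field and prime WITHOUT Lemma 4.6; both this lineage and seat
bsd-inputs-k4-p1 (memo `K4P1-GREENBERG-THM41-SIZING-UPDATE-G7`) record Lemma 4.6 on `Γ`-invariants as the ONE missing input of the
«`≤`» half (and hence of `greenberg_charValue_rankZero` with `E(ℚ)[p] ≠ 0`). THIS FILE isolates that input as a DISPLAYED
HYPOTHESIS in the tree's currency, read at the auxiliary place `v₀ ∉ S` of parts 1–5 —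

  «`h46`»: every `p`-primary class `z ∈ H¹(Γ_{K_{v₀}}, E)(p)` is REALISED over `K_∞` by some `T ∈ H¹(K_∞, E[p^∞])` which is
  Selmer (Kummer at every conjugate place) at all places `≠ v₀` and whose local class at every place above `v₀` is `res z`
  (`∀ σ, loc_{v₀}(conj_σ T) = res z`) — i.e. Lemma 4.6 with `Σ = S ∪ {v₀} ∪ ∞` applied to the `Γ`-invariant vector supported
  above `v₀` —

and builds Greenberg's map `t` on it: `t(z) = [conj_γ T − T] ∈ (Sel_∞)_γ`. The three lemmas:

* `conjH1_sub_mem_selmerInfty_of_realizes` — for such a `T`, `conj_γ T − T ∈ Sel_{p^∞}(E/K_∞)` (and `T ∈ Sel_∞` when `z = 0`: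
  `mem_selmerInfty_of_realizes_zero`);
* `resOfLe_top_realizes` — for `u ∈ U` (the classes of `H¹(Γ_K, E[p^∞])` Kummer at every place `≠ v₀` — see part 8 for the
  comparison with the «unramified outside `S ∪ {v₀}`» version of parts 1–5), `T = res u` realises `z = loc_{v₀} u`, with
  `conj_γ T − T = 0`: `t` kills Cassels' image `loc_{v₀}(U)`;
* `exists_top_of_conjH1_sub_eq` — the KERNEL of `t`: if `conj_γ T − T = conj_γ s − s` with `s ∈ Sel_∞` then (Greenberg's Lemma
  3.2, `ZpExtension.mem_range_resOfLe_of_conjH1_eq`: `T − s = res y`) `z = loc_{v₀} y` for some `y ∈ H¹(Γ_K, E[p^∞])` whose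
  restriction to `K_∞` is Selmer at all places `≠ v₀` — using `𝒦_{v₀,0}[p^∞] = 0` at the GOOD place `v₀ ∤ p` (Lemma 3.3,
  `Greenberg1999.localTowerKerPrimary_eq_bot_of_hasGoodReductionAt`) in the form `eq_zero_of_resOfLe_ker_eq_zero`.

The counting (part 8) turns these into `#ker g₀ · #C_{v₀} ≤ ∏#𝒦 · #(Sel_∞)_γ`, hence — with part 3c — EQUALITY modulo `h46`.

HONEST FRAMING: `h46` is NOT proved here (it is Greenberg's Lemma 4.6 read on `Γ`-invariants; XL in the tree: twists `A_s`,
Prop. 4.13 for `A_s`, or Λ-adic Poitou–Tate); everything else is kernel-checked over tree theorems, for every number field `K`,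
every prime `p` and the cyclotomic `ℤ_p`-extension. Closes no item; no summit statement is proved; the Birch–Swinnerton-Dyer
conjecture is NOT proved by any of this.

References: [GreenbergLNM1716] §3 Lemma 3.2 (p. 86), Lemma 3.3 (pp. 86–87), §4 Lemma 4.6 (pp. 105–107), Lemma 4.7 (pp. 107–108).
-/

noncomputable section

open scoped Classical NumberField

open NumberField IsDedekindDomain Field

namespace Summit.BirchSwinnertonDyer.BirchSwinnertonDyer.Theorems.TorsionEulerChar

open Literature.NumberTheory.EllipticCurves Literature.NumberTheory.GaloisRepresentations
  WeierstrassCurve ZpExtension Literature.NumberTheory.EllipticCurves.IwasawaAlgebra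
  Literature.NumberTheory.EllipticCurves.IwasawaDual
  Literature.NumberTheory.EllipticCurves.GreenbergVatsal2000 Literature.NumberTheory.EllipticCurves.GreenbergSelmer
  Literature.NumberTheory.EllipticCurves.Rank1Residual Summit.BirchSwinnertonDyer.Rank1Residual.X2

variable {K : Type} [Field K] [NumberField K] (W : WeierstrassCurve K) [W.IsElliptic] (p : ℕ) [hp : Fact p.Prime]
  (κ : ZpExtension K p) {γ : absoluteGaloisGroup K}

/-! ## §0 Local transport: `𝒦_{v,0}[p^∞] = 0` at a good `v ∤ p`, read at the level `Γ_{K_v}` -/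

/-- **At a GOOD place `v ∤ p` a `p`-primary local class over `K_v` that dies over `K_{∞,η}` is zero** (Greenberg Lemma 3.3:
`ker(r_v) = 0` for `v ∉ Σ`; tree `Greenberg1999.localTowerKerPrimary_eq_bot_of_hasGoodReductionAt` at the layer `0`, moved from
`H_{v,0}` to `Γ_{K_v}` along `Γ_K = κ⁻¹(p⁰ℤ_p)`). [cite: GreenbergLNM1716, §3 Lemma 3.3 (pp. 86–87) and §4 p. 104] -/
theorem eq_zero_of_resOfLe_ker_eq_zero {v : HeightOneSpectrum (𝓞 K)} (hpv : ((p : ℕ) : 𝓞 K) ∉ v.asIdeal)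
    (hgood : W.HasGoodReductionAt v)
    (d : discreteH1 (localSubgroup (⊤ : Subgroup (absoluteGaloisGroup K)) (v.adicCompletion K))
      (localPoints W (v.adicCompletion K)))
    (hd : ∃ k : ℕ, p ^ k • d = 0)
    (hres : Literature.NumberTheory.EllipticCurves.resOfLe (localPoints W (v.adicCompletion K))
      (Subgroup.comap_mono le_top :
        localSubgroup κ.kerSubgroup (v.adicCompletion K) ≤
          localSubgroup (⊤ : Subgroup (absoluteGaloisGroup K)) (v.adicCompletion K)) d = 0) :
    d = 0 := by
  -- the two local subgroups attached to `⊤` and to the layer `0` coincide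
  have h0top : localSubgroup (κ.layerSubgroup 0) (v.adicCompletion K) ≤
      localSubgroup (⊤ : Subgroup (absoluteGaloisGroup K)) (v.adicCompletion K) := Subgroup.comap_mono le_top
  have htop0 : localSubgroup (⊤ : Subgroup (absoluteGaloisGroup K)) (v.adicCompletion K) ≤
      localSubgroup (κ.layerSubgroup 0) (v.adicCompletion K) :=
    fun τ _ ↦ (mem_localSubgroup_iff _ _ τ).mpr (by rw [ZpExtension.layerSubgroup_zero]; trivial)
  set d' := Literature.NumberTheory.EllipticCurves.resOfLe (localPoints W (v.adicCompletion K)) h0top d with hd'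
  -- `d'` lies in `𝒦_{v,0}[p^∞] = ⊥`
  have hd'mem : d' ∈ W.localTowerKerPrimary κ (v.adicCompletion K) 0 := by
    refine (W.mem_localTowerKerPrimary_iff κ _ 0 _).mpr ⟨?_, ?_⟩
    · rw [W.mem_localTowerKer_iff κ, hd', ← AddMonoidHom.comp_apply,
        resOfLe_comp_holds (M := localPoints W (v.adicCompletion K))]
      exact hres
    · obtain ⟨k, hk⟩ := hd
      exact ⟨k, by rw [hd', ← map_nsmul, hk, map_zero]⟩
  rw [Greenberg1999.localTowerKerPrimary_eq_bot_of_hasGoodReductionAt W κ hpv hgood 0, AddSubgroup.mem_bot] at hd'mem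
  -- restriction along the equality is injective
  have hround : Literature.NumberTheory.EllipticCurves.resOfLe (localPoints W (v.adicCompletion K)) htop0 d' = d := by
    rw [hd', ← AddMonoidHom.comp_apply, resOfLe_comp_holds (M := localPoints W (v.adicCompletion K)) htop0 h0top]
    exact DFunLike.congr_fun (resOfLe_refl_holds (M := localPoints W (v.adicCompletion K)) _) d
  rw [hd'mem] at hround
  exact hround.symm.trans (map_zero _)

omit [NumberField K] [W.IsElliptic] in
/-- Restriction of local classes from `Γ_{K_v}` (attached to `⊤`) to the local subgroup attached to the layer `0` — the SAME
subgroup, `Γ_K = κ⁻¹(p⁰ℤ_p)` — is injective (it has the two-sided inverse `res` along the reverse inclusion). [folklore] -/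
theorem eq_zero_of_resOfLe_layer_zero_eq_zero {E : Type} [Field E] [Algebra K E]
    (d : discreteH1 (localSubgroup (⊤ : Subgroup (absoluteGaloisGroup K)) E) (localPoints W E))
    (hres : Literature.NumberTheory.EllipticCurves.resOfLe (localPoints W E)
      (Subgroup.comap_mono le_top :
        localSubgroup (κ.layerSubgroup 0) E ≤ localSubgroup (⊤ : Subgroup (absoluteGaloisGroup K)) E) d = 0) :
    d = 0 := by
  have h0top : localSubgroup (κ.layerSubgroup 0) E ≤ localSubgroup (⊤ : Subgroup (absoluteGaloisGroup K)) E :=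
    Subgroup.comap_mono le_top
  have htop0 : localSubgroup (⊤ : Subgroup (absoluteGaloisGroup K)) E ≤ localSubgroup (κ.layerSubgroup 0) E :=
    fun τ _ ↦ (mem_localSubgroup_iff _ _ τ).mpr (by rw [ZpExtension.layerSubgroup_zero]; trivial)
  have hround : Literature.NumberTheory.EllipticCurves.resOfLe (localPoints W E) htop0
      (Literature.NumberTheory.EllipticCurves.resOfLe (localPoints W E) h0top d) = d := by
    rw [← AddMonoidHom.comp_apply, resOfLe_comp_holds (M := localPoints W E) htop0 h0top]
    exact DFunLike.congr_fun (resOfLe_refl_holds (M := localPoints W E) _) d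
  have h1 : Literature.NumberTheory.EllipticCurves.resOfLe (localPoints W E) h0top d = 0 := hres
  rw [h1] at hround
  exact hround.symm.trans (map_zero _)

omit [NumberField K] [W.IsElliptic] in
/-- The same transport at an INFINITE place `w` (which splits completely in `K_∞/K`,
`ZpExtension.resGal_infinitePlace_mem_kerSubgroup`): a local class over `K_w` that dies over `(K_∞)_w = K_w` is zero.
[cite: GreenbergLNM1716, §4 p. 107 («for archimedean v … 𝒫^{(v)}(F) ≅ 𝒫^{(v)}(F_∞)^Γ»)] -/
theorem eq_zero_of_resOfLe_ker_eq_zero_infinitePlace (w : InfinitePlace K)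
    (d : discreteH1 (localSubgroup (⊤ : Subgroup (absoluteGaloisGroup K)) w.Completion) (localPoints W w.Completion))
    (hres : Literature.NumberTheory.EllipticCurves.resOfLe (localPoints W w.Completion)
      (Subgroup.comap_mono le_top :
        localSubgroup κ.kerSubgroup w.Completion ≤ localSubgroup (⊤ : Subgroup (absoluteGaloisGroup K)) w.Completion) d = 0) :
    d = 0 := by
  have hle : localSubgroup κ.kerSubgroup w.Completion ≤
      localSubgroup (⊤ : Subgroup (absoluteGaloisGroup K)) w.Completion := Subgroup.comap_mono le_top
  have hge : localSubgroup (⊤ : Subgroup (absoluteGaloisGroup K)) w.Completion ≤ localSubgroup κ.kerSubgroup w.Completion :=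
    fun τ _ ↦ (mem_localSubgroup_iff _ _ τ).mpr (ZpExtension.resGal_infinitePlace_mem_kerSubgroup κ w τ)
  have hround : Literature.NumberTheory.EllipticCurves.resOfLe (localPoints W w.Completion) hge
      (Literature.NumberTheory.EllipticCurves.resOfLe (localPoints W w.Completion) hle d) = d := by
    rw [← AddMonoidHom.comp_apply, resOfLe_comp_holds (M := localPoints W w.Completion) hge hle]
    exact DFunLike.congr_fun (resOfLe_refl_holds (M := localPoints W w.Completion) _) d
  have h1 : Literature.NumberTheory.EllipticCurves.resOfLe (localPoints W w.Completion) hle d = 0 := hres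
  rw [h1] at hround
  exact hround.symm.trans (map_zero _)

omit [NumberField K] [W.IsElliptic] in
/-- Restriction `H¹(Γ_K, E[p^∞]) → H¹(K_∞, E[p^∞])` commutes with the local restrictions at a completion `E`:
`loc^∞(res y) = res(loc^⊤ y)` (tree `localResOverOfEmb_resOfLe` at the chosen embedding). [cite: GreenbergLNM1716, §3 p. 86] -/
theorem localResOver_resOfLe_top {E : Type} [Field E] [Algebra K E]
    (y : W.subgroupH1 p (⊤ : Subgroup (absoluteGaloisGroup K))) :
    W.localResOver p κ.kerSubgroup E (W.resOfLe p (le_top : κ.kerSubgroup ≤ ⊤) y) =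
      Literature.NumberTheory.EllipticCurves.resOfLe (localPoints W E)
        (Subgroup.comap_mono le_top : localSubgroup κ.kerSubgroup E ≤ localSubgroup (⊤ : Subgroup (absoluteGaloisGroup K)) E)
        (W.localResOver p ⊤ E y) :=
  W.localResOverOfEmb_resOfLe p (closureEmb (K := K) E) (le_top : κ.kerSubgroup ≤ ⊤) y

/-! ## §1 Realisers: `conj_γ T − T ∈ Sel_∞`, and `T ∈ Sel_∞` when the realised class is `0` -/

omit [W.IsElliptic] in
/-- **If `T ∈ H¹(K_∞, E[p^∞])` is Selmer at every place `≠ v₀` and has the SAME local class `c` at every place above `v₀`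
(`∀ σ, loc_{v₀}(conj_σ T) = c`), then `conj_τ T − T ∈ Sel_{p^∞}(E/K_∞)` for every `τ ∈ Γ_K`** (`conj_σ(conj_τ T − T) =
conj_{στ} T − conj_σ T`: both Selmer conditions at `v ≠ v₀` and at `∞`, and local class `c − c = 0` above `v₀`).
[cite: GreenbergLNM1716, §4 Lemma 4.7 (p. 108, the map t)] -/
theorem conjH1_sub_mem_selmerInfty_of_realizes (v₀ : HeightOneSpectrum (𝓞 K)) (T : W.subgroupH1 p κ.kerSubgroup)
    (c : discreteH1 (localSubgroup κ.kerSubgroup (v₀.adicCompletion K)) (localPoints W (v₀.adicCompletion K)))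
    (hTv : ∀ v : HeightOneSpectrum (𝓞 K), v ≠ v₀ → ∀ σ : absoluteGaloisGroup K,
      W.conjH1 p κ.kerSubgroup σ T ∈ W.localKerOver p κ.kerSubgroup (v.adicCompletion K))
    (hTw : ∀ (w : InfinitePlace K) (σ : absoluteGaloisGroup K),
      W.conjH1 p κ.kerSubgroup σ T ∈ W.localKerOver p κ.kerSubgroup w.Completion)
    (hT0 : ∀ σ : absoluteGaloisGroup K,
      W.localResOver p κ.kerSubgroup (v₀.adicCompletion K) (W.conjH1 p κ.kerSubgroup σ T) = c)
    (τ : absoluteGaloisGroup K) :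
    W.conjH1 p κ.kerSubgroup τ T - T ∈ W.selmerInfty κ := by
  have hmul : ∀ σ : absoluteGaloisGroup K, W.conjH1 p κ.kerSubgroup σ (W.conjH1 p κ.kerSubgroup τ T - T) =
      W.conjH1 p κ.kerSubgroup (σ * τ) T - W.conjH1 p κ.kerSubgroup σ T := fun σ ↦ by
    rw [map_sub, W.conjH1_mul_holds p κ.kerSubgroup σ τ, AddMonoidHom.comp_apply]
  refine (W.mem_selmerGroupOver_iff p κ.kerSubgroup _).mpr ⟨fun v σ ↦ ?_, fun w σ ↦ ?_⟩
  · rw [hmul σ]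
    by_cases hv : v = v₀
    · subst hv
      rw [W.mem_localKerOver_iff, map_sub, hT0, hT0, sub_self]
    · exact sub_mem (hTv v hv (σ * τ)) (hTv v hv σ)
  · rw [hmul σ]
    exact sub_mem (hTw w (σ * τ)) (hTw w σ)

omit [W.IsElliptic] in
/-- **A realiser of the ZERO class is a Selmer class**: `T` Selmer at every place `≠ v₀` with local class `0` at every place
above `v₀` lies in `Sel_{p^∞}(E/K_∞)`. [cite: GreenbergLNM1716, §2 (Selmer group over F_∞) and §4 Lemma 4.7] -/
theorem mem_selmerInfty_of_realizes_zero (v₀ : HeightOneSpectrum (𝓞 K)) (T : W.subgroupH1 p κ.kerSubgroup)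
    (hTv : ∀ v : HeightOneSpectrum (𝓞 K), v ≠ v₀ → ∀ σ : absoluteGaloisGroup K,
      W.conjH1 p κ.kerSubgroup σ T ∈ W.localKerOver p κ.kerSubgroup (v.adicCompletion K))
    (hTw : ∀ (w : InfinitePlace K) (σ : absoluteGaloisGroup K),
      W.conjH1 p κ.kerSubgroup σ T ∈ W.localKerOver p κ.kerSubgroup w.Completion)
    (hT0 : ∀ σ : absoluteGaloisGroup K,
      W.localResOver p κ.kerSubgroup (v₀.adicCompletion K) (W.conjH1 p κ.kerSubgroup σ T) = 0) :
    T ∈ W.selmerInfty κ := by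
  refine (W.mem_selmerGroupOver_iff p κ.kerSubgroup _).mpr ⟨fun v σ ↦ ?_, fun w σ ↦ hTw w σ⟩
  by_cases hv : v = v₀
  · subst hv
    rw [W.mem_localKerOver_iff]
    exact hT0 σ
  · exact hTv v hv σ

/-! ## §2 Restricted classes: `res u` realises `loc_{v₀} u`, with `conj_γ(res u) − res u = 0` -/

omit [W.IsElliptic] in
/-- **`t` kills Cassels' image.** For `u ∈ H¹(Γ_K, E[p^∞])` Kummer at every finite place `≠ v₀` and at every infinite place
(at level `Γ_K`), and the cyclotomic `κ`: `T := res u ∈ H¹(K_∞, E[p^∞])` is `Γ_K`-invariant (`conj_σ T = T`), Selmer at every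
place `≠ v₀`, and its local class at every place above `v₀` is `res(loc_{v₀} u)`. (Restriction commutes with localisation; at
the finite `v ≠ v₀` and at `∞` the vanishing local class restricts to a vanishing one.) [cite: GreenbergLNM1716, §3 p. 86 and
§4 Lemma 4.7 (p. 108: «It is also clear that Im(a) is mapped … to Im(b)»)] -/
theorem resOfLe_top_realizes (v₀ : HeightOneSpectrum (𝓞 K)) (u : W.subgroupH1 p (⊤ : Subgroup (absoluteGaloisGroup K)))
    (huv : ∀ v : HeightOneSpectrum (𝓞 K), v ≠ v₀ → u ∈ W.localKerOver p ⊤ (v.adicCompletion K))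
    (huw : ∀ w : InfinitePlace K, u ∈ W.localKerOver p ⊤ w.Completion) :
    (∀ σ : absoluteGaloisGroup K,
        W.conjH1 p κ.kerSubgroup σ (W.resOfLe p (le_top : κ.kerSubgroup ≤ ⊤) u) =
          W.resOfLe p (le_top : κ.kerSubgroup ≤ ⊤) u) ∧
      (∀ v : HeightOneSpectrum (𝓞 K), v ≠ v₀ → ∀ σ : absoluteGaloisGroup K,
        W.conjH1 p κ.kerSubgroup σ (W.resOfLe p (le_top : κ.kerSubgroup ≤ ⊤) u) ∈
          W.localKerOver p κ.kerSubgroup (v.adicCompletion K)) ∧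
      (∀ (w : InfinitePlace K) (σ : absoluteGaloisGroup K),
        W.conjH1 p κ.kerSubgroup σ (W.resOfLe p (le_top : κ.kerSubgroup ≤ ⊤) u) ∈
          W.localKerOver p κ.kerSubgroup w.Completion) ∧
      ∀ σ : absoluteGaloisGroup K,
        W.localResOver p κ.kerSubgroup (v₀.adicCompletion K)
            (W.conjH1 p κ.kerSubgroup σ (W.resOfLe p (le_top : κ.kerSubgroup ≤ ⊤) u)) =
          Literature.NumberTheory.EllipticCurves.resOfLe (localPoints W (v₀.adicCompletion K))
            (Subgroup.comap_mono le_top :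
              localSubgroup κ.kerSubgroup (v₀.adicCompletion K) ≤
                localSubgroup (⊤ : Subgroup (absoluteGaloisGroup K)) (v₀.adicCompletion K))
            (W.localResOver p ⊤ (v₀.adicCompletion K) u) := by
  have hconj : ∀ σ : absoluteGaloisGroup K,
      W.conjH1 p κ.kerSubgroup σ (W.resOfLe p (le_top : κ.kerSubgroup ≤ ⊤) u) =
        W.resOfLe p (le_top : κ.kerSubgroup ≤ ⊤) u := fun σ ↦ SSFlatEC.conjH1_resOfLe_top W κ σ u
  refine ⟨hconj, fun v hv σ ↦ ?_, fun w σ ↦ ?_, fun σ ↦ ?_⟩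
  · rw [hconj σ, W.mem_localKerOver_iff]
    have h0 : W.localResOver p ⊤ (v.adicCompletion K) u = 0 :=
      (W.mem_localKerOver_iff p ⊤ (v.adicCompletion K) u).mp (huv v hv)
    refine (localResOver_resOfLe_top W p κ u).trans ?_
    rw [h0]
    exact map_zero _
  · rw [hconj σ, W.mem_localKerOver_iff]
    have h0 : W.localResOver p ⊤ w.Completion u = 0 := (W.mem_localKerOver_iff p ⊤ w.Completion u).mp (huw w)
    refine (localResOver_resOfLe_top W p κ u).trans ?_
    rw [h0]
    exact map_zero _
  · rw [hconj σ]
    exact localResOver_resOfLe_top W p κ u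

/-! ## §3 The kernel of `t`: Greenberg's Lemma 3.2 + Lemma 3.3 at `v₀` -/

/-- **The kernel of `t`.** Let `v₀` be a GOOD place with `v₀ ∤ p`, `γ` a topological generator of the cyclotomic-or-not
`ℤ_p`-extension `κ`, `T ∈ H¹(K_∞, E[p^∞])` Selmer at every place `≠ v₀` with local class `res z` at every place above `v₀`
(`z ∈ H¹(Γ_{K_{v₀}}, E)` `p`-primary), and `s ∈ Sel_{p^∞}(E/K_∞)` with `conj_γ T − T = conj_γ s − s`. Then `z = loc_{v₀} y` for
some `y ∈ H¹(Γ_K, E[p^∞])` whose restriction to `K_∞` is Selmer at every place `≠ v₀` (namely `res y = T − s`: Greenberg's Lemma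
3.2 `H¹(Γ_K, E[p^∞]) ↠ H¹(K_∞, E[p^∞])^Γ`, tree `ZpExtension.mem_range_resOfLe_of_conjH1_eq`, then `res(z − loc_{v₀} y) = 0` and
Lemma 3.3 at `v₀`, `eq_zero_of_resOfLe_ker_eq_zero`). [cite: GreenbergLNM1716, §3 Lemma 3.2 (p. 86), Lemma 3.3 (pp. 86–87),
§4 Lemma 4.7 (p. 108: exactness of `0 → ker g → ker r → ker t`)] -/
theorem exists_top_of_conjH1_sub_eq (hγ : κ.IsTopGenerator γ) (v₀ : HeightOneSpectrum (𝓞 K))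
    (hpv₀ : ((p : ℕ) : 𝓞 K) ∉ v₀.asIdeal) (hgood₀ : W.HasGoodReductionAt v₀)
    (z : discreteH1 (localSubgroup (⊤ : Subgroup (absoluteGaloisGroup K)) (v₀.adicCompletion K))
      (localPoints W (v₀.adicCompletion K)))
    (hz : ∃ k : ℕ, p ^ k • z = 0)
    (T : W.subgroupH1 p κ.kerSubgroup)
    (hTv : ∀ v : HeightOneSpectrum (𝓞 K), v ≠ v₀ → ∀ σ : absoluteGaloisGroup K,
      W.conjH1 p κ.kerSubgroup σ T ∈ W.localKerOver p κ.kerSubgroup (v.adicCompletion K))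
    (hTw : ∀ (w : InfinitePlace K) (σ : absoluteGaloisGroup K),
      W.conjH1 p κ.kerSubgroup σ T ∈ W.localKerOver p κ.kerSubgroup w.Completion)
    (hT0 : ∀ σ : absoluteGaloisGroup K,
      W.localResOver p κ.kerSubgroup (v₀.adicCompletion K) (W.conjH1 p κ.kerSubgroup σ T) =
        Literature.NumberTheory.EllipticCurves.resOfLe (localPoints W (v₀.adicCompletion K))
          (Subgroup.comap_mono le_top :
            localSubgroup κ.kerSubgroup (v₀.adicCompletion K) ≤
              localSubgroup (⊤ : Subgroup (absoluteGaloisGroup K)) (v₀.adicCompletion K)) z)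
    (s : W.subgroupH1 p κ.kerSubgroup) (hs : s ∈ W.selmerInfty κ)
    (heq : W.conjH1 p κ.kerSubgroup γ T - T = W.conjH1 p κ.kerSubgroup γ s - s) :
    ∃ y : W.subgroupH1 p (⊤ : Subgroup (absoluteGaloisGroup K)),
      W.resOfLe p (le_top : κ.kerSubgroup ≤ ⊤) y = T - s ∧
      (∀ v : HeightOneSpectrum (𝓞 K), v ≠ v₀ → ∀ σ : absoluteGaloisGroup K,
        W.conjH1 p κ.kerSubgroup σ (W.resOfLe p (le_top : κ.kerSubgroup ≤ ⊤) y) ∈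
          W.localKerOver p κ.kerSubgroup (v.adicCompletion K)) ∧
      (∀ (w : InfinitePlace K) (σ : absoluteGaloisGroup K),
        W.conjH1 p κ.kerSubgroup σ (W.resOfLe p (le_top : κ.kerSubgroup ≤ ⊤) y) ∈
          W.localKerOver p κ.kerSubgroup w.Completion) ∧
      W.localResOver p ⊤ (v₀.adicCompletion K) y = z := by
  have hsel := (W.mem_selmerGroupOver_iff p κ.kerSubgroup s).mp hs
  -- `x = T − s` is fixed by `conj_γ`
  set x : W.subgroupH1 p κ.kerSubgroup := T - s with hx
  have hfix : W.conjH1 p κ.kerSubgroup γ x = x := by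
    rw [hx, map_sub]
    exact sub_eq_sub_iff_sub_eq_sub.mp heq
  -- Greenberg's Lemma 3.2 at `n = 0`: `x = res y`
  have hprim : ∀ m : W.geomPrimaryTorsion p, ∃ k : ℕ, p ^ k • m = 0 := fun m ↦ by
    obtain ⟨k, hk⟩ := m.2
    exact ⟨k, Subtype.ext (by rw [AddSubgroupClass.coe_nsmul, hk, ZeroMemClass.coe_zero])⟩
  have hfix' : W.conjH1 p κ.kerSubgroup (γ ^ p ^ 0) x = x := by rwa [pow_zero, pow_one]
  obtain ⟨y₀, hy₀⟩ := ZpExtension.mem_range_resOfLe_of_conjH1_eq κ hγ 0 (W.continuous_smul_geomPrimaryTorsion p) hprim x hfix'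
  have htop : (⊤ : Subgroup (absoluteGaloisGroup K)) ≤ κ.layerSubgroup 0 :=
    fun g _ ↦ by rw [ZpExtension.layerSubgroup_zero]; trivial
  set y : W.subgroupH1 p (⊤ : Subgroup (absoluteGaloisGroup K)) := W.resOfLe p htop y₀ with hydef
  have hy : W.resOfLe p (le_top : κ.kerSubgroup ≤ ⊤) y = x := by
    rw [hydef, ← AddMonoidHom.comp_apply, W.resOfLe_comp_holds p (le_top : κ.kerSubgroup ≤ ⊤) htop]
    exact hy₀
  refine ⟨y, hy, fun v hv σ ↦ ?_, fun w σ ↦ ?_, ?_⟩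
  · rw [hy, hx, map_sub]
    exact sub_mem (hTv v hv σ) (hsel.1 v σ)
  · rw [hy, hx, map_sub]
    exact sub_mem (hTw w σ) (hsel.2 w σ)
  · -- `res(z − loc_{v₀} y) = 0`, hence `z = loc_{v₀} y` (Lemma 3.3 at the good place `v₀`)
    have hone : W.conjH1 p κ.kerSubgroup 1 T = T := by
      rw [W.conjH1_one_holds p κ.kerSubgroup, AddMonoidHom.id_apply]
    have hs0 : W.localResOver p κ.kerSubgroup (v₀.adicCompletion K) s = 0 := by
      have h1 := hsel.1 v₀ 1
      rwa [W.conjH1_one_holds p κ.kerSubgroup, AddMonoidHom.id_apply] at h1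
    have hloc : W.localResOver p κ.kerSubgroup (v₀.adicCompletion K) x =
        Literature.NumberTheory.EllipticCurves.resOfLe (localPoints W (v₀.adicCompletion K))
          (Subgroup.comap_mono le_top :
            localSubgroup κ.kerSubgroup (v₀.adicCompletion K) ≤
              localSubgroup (⊤ : Subgroup (absoluteGaloisGroup K)) (v₀.adicCompletion K)) z := by
      rw [hx, map_sub, hs0, sub_zero, ← hone]
      exact hT0 1
    have hres : W.localResOver p κ.kerSubgroup (v₀.adicCompletion K) x =
        Literature.NumberTheory.EllipticCurves.resOfLe (localPoints W (v₀.adicCompletion K))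
          (Subgroup.comap_mono le_top :
            localSubgroup κ.kerSubgroup (v₀.adicCompletion K) ≤
              localSubgroup (⊤ : Subgroup (absoluteGaloisGroup K)) (v₀.adicCompletion K))
          (W.localResOver p ⊤ (v₀.adicCompletion K) y) := by
      have h := localResOver_resOfLe_top W p κ (E := v₀.adicCompletion K) y
      rw [hy] at h
      exact h
    have hzy : Literature.NumberTheory.EllipticCurves.resOfLe (localPoints W (v₀.adicCompletion K))
          (Subgroup.comap_mono le_top :
            localSubgroup κ.kerSubgroup (v₀.adicCompletion K) ≤
              localSubgroup (⊤ : Subgroup (absoluteGaloisGroup K)) (v₀.adicCompletion K)) z =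
        Literature.NumberTheory.EllipticCurves.resOfLe (localPoints W (v₀.adicCompletion K))
          (Subgroup.comap_mono le_top :
            localSubgroup κ.kerSubgroup (v₀.adicCompletion K) ≤
              localSubgroup (⊤ : Subgroup (absoluteGaloisGroup K)) (v₀.adicCompletion K))
          (W.localResOver p ⊤ (v₀.adicCompletion K) y) := hloc.symm.trans hres
    have hd : Literature.NumberTheory.EllipticCurves.resOfLe (localPoints W (v₀.adicCompletion K))
        (Subgroup.comap_mono le_top :
          localSubgroup κ.kerSubgroup (v₀.adicCompletion K) ≤
            localSubgroup (⊤ : Subgroup (absoluteGaloisGroup K)) (v₀.adicCompletion K))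
        (z - W.localResOver p ⊤ (v₀.adicCompletion K) y) = 0 :=
      (map_sub _ _ _).trans (by rw [hzy, sub_self])
    have hprim' : ∃ k : ℕ, p ^ k • (z - W.localResOver p ⊤ (v₀.adicCompletion K) y) = 0 := by
      obtain ⟨k, hk⟩ := hz
      obtain ⟨l, hl⟩ := SignedEC.H1SigmaCorank.exists_pow_smul_eq_zero_subgroupH1_top W p y
      refine ⟨k + l, ?_⟩
      rw [smul_sub, pow_add, mul_comm, mul_smul, hk, smul_zero, mul_comm, mul_smul, ← map_nsmul, hl, map_zero,
        smul_zero, sub_zero]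
    have h0 := eq_zero_of_resOfLe_ker_eq_zero W p κ hpv₀ hgood₀ _ hprim' hd
    exact (sub_eq_zero.mp h0).symm

end Summit.BirchSwinnertonDyer.BirchSwinnertonDyer.Theorems.TorsionEulerChar

end
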